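import Literature.Topology.FourManifolds.BoundarySliceMorseData
import Literature.Topology.FourManifolds.AdaptedMorseConnected
import Literature.Topology.FourManifolds.Trisections
import HarnessLib

/-!
# The normal form of a face of a trisection, and the face clause it yields

Topic `Literature/Topology/FourManifolds`; infrastructure for the fact seat
`provefact-Literature.Topology.FourManifolds.exists-14560f9fc8` (named fact (c′)
`Literature.Topology.FourManifolds.exists_stabilized_gkTrisection`, Gay–Kirby 2016, Def. 8 and
Lemma 10).  This file introduces **one definition** (the structure `FaceNormalForm`) and proves
the recognition theorem `FaceNormalForm.face_clause`; no named facts.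

A **face** `Q = S a ∩ S b` of a Gay–Kirby trisection is a compact `3`-dimensional submanifold
of the closed `4`-manifold `X` with boundary the central surface `F`.  Its normal form, the
companion of `SectorNormalForm` (`TrisectionsSectorNormalForm.lean`) used to follow the faces
through the stabilisation implant, records: `Q` compact, `F ⊆ Q ⊆ …`, the description
`Q ∩ U = {nrm = 0, 0 ≤ col}` and `F ∩ U = {nrm = col = 0}` by two global smooth functions
(the normal and the collar coordinate of the face: `(u, v)`, `(v, u)` or `(u - v, -u)`), and
the **Morse data**: a boundary slice atlas `Φ` of `Q` (`BoundarySliceCharts.lean`, Lee 2013,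
Thm. 5.51) whose charts detect `F` as the boundary, and a smooth ambient `G` with
`G = 1 - col · λ` (`λ > 0`) near `F`, `G < 1` on `Q ∖ F`, whose restriction to `Q` (structure
`Φ.chartedSpace`) has only nondegenerate critical points, all off `F`, `c n` of index `n`.
The recognition theorem turns this into clause (iii) of `IsGKTrisection` for the pair `(a, b)`
with `handleCount 1 g`: `H = ↥Q`, the inclusion a smooth embedding
(`isSmoothEmbedding_subtype_val`), `G|Q` adapted to the boundary, connected by its single
minimum (`HasHandleDecomposition.connectedSpace`), boundary image `F` (`image_boundary_eq`).

## References

* D. Gay, R. Kirby, *Trisecting 4-manifolds*, Geom. Topol. 20 (2016) 3097–3132, Def. 1,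
  Def. 8, Lemma 10. [GayKirby2016]
* J. M. Lee, *Introduction to Smooth Manifolds* (2013), Thm. 5.51. [LeeSmoothManifolds2013]
* J. Milnor, *Lectures on the h-cobordism theorem* (1965), Def. 3.1. [MilnorHCobordism1965]
-/

open scoped Manifold ContDiff Topology
open Set Function Filter

noncomputable section

namespace Literature.Topology.FourManifolds

universe u

section Face

variable {X : Type u} [TopologicalSpace X] [ChartedSpace (EuclideanSpace ℝ (Fin 4)) X]

/-- **Normal form of a face of a trisection** relative to the corner locus `F`, the normal and
collar coordinates `nrm, col`, the open set `U` and the critical-point counts `c`.  See the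
module docstring. [cite: GayKirby2016, Def. 1; LeeSmoothManifolds2013, Thm. 5.51] -/
structure FaceNormalForm (Q F : Set X) (nrm col : X → ℝ) (U : Set X) (c : ℕ → ℕ) : Prop where
  /-- The face is compact. -/
  isCompact : IsCompact Q
  /-- The corner locus lies on the face. -/
  F_subset : F ⊆ Q
  /-- The corner locus lies in `U`. -/
  F_subset_U : F ⊆ U
  /-- `U` is open. -/
  isOpen_U : IsOpen U
  /-- In `U` the face is `{nrm = 0, 0 ≤ col}`. -/
  mem_iff : ∀ y ∈ U, y ∈ Q ↔ nrm y = 0 ∧ 0 ≤ col y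
  /-- In `U` the corner locus is `{nrm = col = 0}`. -/
  memF_iff : ∀ y ∈ U, y ∈ F ↔ nrm y = 0 ∧ col y = 0
  /-- The normal coordinate is smooth. -/
  contMDiff_nrm : ContMDiff (𝓡 4) 𝓘(ℝ, ℝ) ∞ nrm
  /-- The collar coordinate is smooth. -/
  contMDiff_col : ContMDiff (𝓡 4) 𝓘(ℝ, ℝ) ∞ col
  /-- The Morse data: a boundary slice atlas detecting `F` as the boundary and an ambient
  function of collar form near `F` whose restriction is Morse with counts `c`. -/
  morse : ∃ (Φ : BoundarySliceAtlas 2 Q) (G lam : X → ℝ) (Ol : Set X),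
    (∀ p : ↥Q, (Φ.datum p).Θ p.1 0 = 0 ↔ p.1 ∈ F) ∧
    ContMDiff (𝓡 4) 𝓘(ℝ, ℝ) ∞ G ∧ ContMDiff (𝓡 4) 𝓘(ℝ, ℝ) ∞ lam ∧ IsOpen Ol ∧ F ⊆ Ol ∧ Ol ⊆ U ∧
    (∀ y ∈ Ol, 0 < lam y) ∧ (∀ y ∈ Ol, G y = 1 - col y * lam y) ∧
    (∀ p ∈ Q, p ∉ F → G p < 1) ∧
    (letI := Φ.chartedSpace
     (∀ p : ↥Q, IsMCriticalPt (𝓡∂ 3) (G ∘ Subtype.val : ↥Q → ℝ) p →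
        p.1 ∉ F ∧ (mhessian (𝓡∂ 3) (G ∘ Subtype.val : ↥Q → ℝ) p).Nondegenerate) ∧
     ∀ n, (criticalSetOfIndex (𝓡∂ 3) (G ∘ Subtype.val : ↥Q → ℝ) n).ncard = c n)

/-- **The face clause of `IsGKTrisection` from a face in normal form.**  See the module
docstring. [cite: GayKirby2016, Def. 1; LeeSmoothManifolds2013, Thm. 5.51;
MilnorHCobordism1965, Def. 3.1] -/
theorem FaceNormalForm.face_clause [T2Space X] [IsManifold (𝓡 4) ∞ X] {Q F : Set X}
    {nrm col : X → ℝ} {U : Set X} {g : ℕ} (hQ : FaceNormalForm Q F nrm col U (handleCount 1 g)) :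
    ∃ (H : Type u) (_ : TopologicalSpace H) (_ : ChartedSpace (EuclideanHalfSpace 3) H)
      (h : H → X), IsManifold (𝓡∂ 3) ∞ H ∧ CompactSpace H ∧ ConnectedSpace H ∧
        HasHandleDecomposition 2 H (handleCount 1 g) ∧
        Manifold.IsSmoothEmbedding (𝓡∂ 3) (𝓡 4) ∞ h ∧ range h = Q ∧
        h '' (𝓡∂ 3).boundary H = F := by
  obtain ⟨Φ, G, lam, Ol, hΦF, hGs, -, -, hFOl, hOlU, -, hGform, hlt, hcrit, hcount⟩ := hQ.morse
  letI := Φ.chartedSpace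
  haveI := Φ.isManifold
  haveI : CompactSpace ↥Q := isCompact_iff_compactSpace.1 hQ.isCompact
  -- the restriction of `G` is a Morse function adapted to the boundary
  have hGval : ContMDiff (𝓡∂ 3) 𝓘(ℝ, ℝ) ∞ (G ∘ Subtype.val : ↥Q → ℝ) :=
    hGs.comp Φ.contMDiff_subtype_val
  have hbdF : ∀ p : ↥Q, (𝓡∂ 3).IsBoundaryPoint p ↔ p.1 ∈ F := fun p => by
    rw [Φ.isBoundaryPoint_iff p, hΦF p]
  have hadapted : IsMorseAdapted (𝓡∂ 3) (G ∘ Subtype.val : ↥Q → ℝ) := by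
    refine ⟨⟨hGval, fun p hp => (hcrit p hp).2⟩, fun p hp => ?_, fun p hp => ?_⟩
    · have hpF : p.1 ∈ F := (hbdF p).1 hp
      refine ⟨?_, fun hc => (hcrit p hc).1 hpF⟩
      obtain ⟨-, hcol⟩ := (hQ.memF_iff p.1 (hQ.F_subset_U hpF)).1 hpF
      show G p.1 = 1
      rw [hGform p.1 (hFOl hpF), hcol, zero_mul, sub_zero]
    · have hpF : p.1 ∉ F := fun hpF =>
        (ModelWithCorners.isInteriorPoint_iff_not_isBoundaryPoint p).1 hp ((hbdF p).2 hpF)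
      exact hlt p.1 p.2 hpF
  have hHD : HasHandleDecomposition 2 ↥Q (handleCount 1 g) := ⟨G ∘ Subtype.val, hadapted, hcount⟩
  haveI : ConnectedSpace ↥Q := hHD.connectedSpace (handleCount_zero 1 g)
  refine ⟨↥Q, inferInstance, Φ.chartedSpace, Subtype.val, Φ.isManifold, inferInstance, inferInstance,
    hHD, Φ.isSmoothEmbedding_subtype_val, Subtype.range_val, ?_⟩
  rw [Φ.image_boundary_eq]
  ext x
  simp only [mem_setOf_eq]
  constructor
  · rintro ⟨hxQ, h0⟩; exact (hΦF ⟨x, hxQ⟩).1 h0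
  · intro hxF; exact ⟨hQ.F_subset hxF, (hΦF ⟨x, hQ.F_subset hxF⟩).2 hxF⟩

end Face

end Literature.Topology.FourManifolds
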